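import Summits.Langlands.Langlands.Theses.EisensteinGelfandKirillov
import Summits.Langlands.Langlands.Theorems.IrreducibilityBySelfDualityHeckeEigenvalueFieldBorelSerre
import Literature.NumberTheory.Automorphic.ResGLnCohomologyFiniteDimensional
import Mathlib.NumberTheory.Padics.Complex
import HarnessLib

/-!
# Stub S4-fd of line `torsion-weight-exchange`: the classical receptacle
# `H^q(S_{K_f(𝔫)}, Ẽ_λ(ℚ̄_p))` is finite-dimensional (UNCONDITIONAL)

Crux `Summit.Langlands.Langlands.Theses.EisensteinGelfandKirillov.CrystallineProModularClassical`
(stmt-Langlands-18274), line `torsion-weight-exchange`, registered stub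
`stub_finiteDimensional_levelCohomology` (lead reshape rev 2: the Borel–Serre input of the "First
lemma" S4, split off so that `stub_exactOccupancy` is pure algebra).

WHAT IS PROVED (no hypothesis beyond the registered signature; axioms
`{propext, Classical.choice, Quot.sound}`): for a totally real number field `F`, a prime `p`, a
non-zero ideal `𝔫 ⊆ 𝓞 F`, any weight `λ : (F →+* ℚ̄_p) → (Fin 2 → ℤ)` and any degree `q`, the Betti
receptacle `ResGLnCohomology.levelCohomology (PadicAlgCl p) 2 F 𝔫 λ q =
H^q(GL₂(F)⁺, Fun(GL₂(𝔸_F^∞)/K_f(𝔫), E_λ(ℚ̄_p)))` is finite-dimensional over `ℚ̄_p = PadicAlgCl p`.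

HOW.  Two tree inputs, composed in one line:

* `ResGLnCohomology.finiteDimensional_levelCohomology_of_borelSerre'`
  (`Literature/NumberTheory/Automorphic/ResGLnCohomologyFiniteDimensional.lean`, landed for this stub
  as p158966: the field-general version of the `ℂ`-only
  `finiteDimensional_levelCohomology_of_borelSerre` of `ClozelAlgebraicityHeckeFieldResFiniteProofs`;
  Shapiro over the finitely many `GL_n(K)⁺`-orbits on `GL_n(𝔸_K^∞)/K_f(𝔫)`, each stabiliser
  `Γ_x = Γ_{Stab x} ∩ GL_n(K)⁺` of finite index in a congruence subgroup, `E_λ(k)` finite-dimensional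
  over every field `k`) — finite-dimensionality over ANY coefficient field `k`, any `n`, any number
  field `K`, GIVEN the named fact
  `Literature.NumberTheory.Automorphic.BorelSerre1973_finiteDimensional_groupCohomology_congruenceSubgroup`;
* `Summit.Langlands.Langlands.Theorems.HeckeEigenvalueField.Res.borelSerre1973_finiteDimensional_groupCohomology_congruenceSubgroup_holds`
  (`Summits/Langlands/Langlands/Theorems/IrreducibilityBySelfDualityHeckeEigenvalueFieldBorelSerre.lean`,
  crux `HeckeEigenvalueField`, line `Sketch`): the named fact is a THEOREM of the tree — Brown's
  criterion in Čech form on the cone model of `GL_n` over a number field with the Siegel-reduced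
  good cover (stubs HULL-CONVEX / HULL-RELOPEN / HULL-POSDEF / SANDWICH-IN / SANDWICH-OUT and
  `stub_borelSerre_assembly`), for EVERY `n` and EVERY number field `K`.

So the Borel–Serre "debt" of the line card is already paid in the tree (for all `n`, `K`, `k`); the
hypotheses `IsTotallyReal F` and `n = 2` of the registered signature are not used by the proof (they
are the shape the composition `CrystallineProModularClassical_of` consumes).

WHAT WAS TRIED / NOT NEEDED.  The brief's fallback (B) — a conditional
`stub_finiteDimensional_levelCohomology_of_borelSerre (hBS : BorelSerre1973_…)` attached as
evidence — is superseded by the unconditional proof; the feasibility question (C) — discharging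
Borel–Serre for `n = 2`, `F` totally real by a Koecher-cone good cover as in
`BianchiCusp.isCohFiniteTypeUpTo_glIntegersRange` — is moot: the general-`n`, general-`K` discharge
`borelSerre1973_finiteDimensional_groupCohomology_congruenceSubgroup_holds` exists (see the note at
the end of this file).
-/

set_option linter.dupNamespace false -- project-wide: `Summit.Langlands.Langlands` is the mandated namespace

noncomputable section

open Summit.Langlands.Langlands.Theses.EisensteinGelfandKirillov
open Literature.NumberTheory.Automorphic Literature.NumberTheory.GaloisRepresentations
open Literature.NumberTheory.Automorphic.BigHeckeGLn Literature.NumberTheory.PAdicHodge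
open NumberField IsDedekindDomain Filter
open scoped Classical

namespace Summit.Langlands.Langlands.Cruxes.CrystallineProModularClassical.TorsionWeightExchange

/-- **Stub S4-fd (Borel–Serre; UNCONDITIONAL): the classical receptacle is finite-dimensional.**
For `F` totally real, `p` prime, `𝔫 ≠ 0`, any weight `λ` and degree `q`,
`H^q(S_{K_f(𝔫)}, Ẽ_λ(ℚ̄_p)) = ResGLnCohomology.levelCohomology (PadicAlgCl p) 2 F 𝔫 λ q` is
finite-dimensional over `ℚ̄_p`.  Proof: the field-general Shapiro reduction
`ResGLnCohomology.finiteDimensional_levelCohomology_of_borelSerre'` (any coefficient field, here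
`k = PadicAlgCl p`) fed with the tree's DISCHARGE
`HeckeEigenvalueField.Res.borelSerre1973_finiteDimensional_groupCohomology_congruenceSubgroup_holds`
of the named fact `BorelSerre1973_finiteDimensional_groupCohomology_congruenceSubgroup` (congruence
subgroups of `GL_n` over any number field have finite-dimensional cohomology on finite-dimensional
coefficients over any field — Borel–Serre 1973, §11.1 (c), Thm. 11.4.4, 11.6, proved in the tree by
Brown's criterion on the Siegel-reduced good cover of the cone model).  The hypotheses
`IsTotallyReal F` and `n = 2` are not used. [cite: BorelSerre1973, §11.1 (c), Thm. 11.4.4, 11.6] -/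
theorem stub_finiteDimensional_levelCohomology : ∀ (F : Type) [Field F] [NumberField F], NumberField.IsTotallyReal F → ∀ (p : ℕ) [Fact p.Prime] (𝔫 : Ideal (NumberField.RingOfIntegers F)), 𝔫 ≠ 0 → ∀ (lam : (F →+* PadicAlgCl p) → Fin 2 → ℤ) (q : ℕ), FiniteDimensional (PadicAlgCl p) (Literature.NumberTheory.Automorphic.ResGLnCohomology.levelCohomology (PadicAlgCl p) 2 F 𝔫 lam q) := by
  intro F _ _ _hF p _ 𝔫 h𝔫 lam q
  exact ResGLnCohomology.finiteDimensional_levelCohomology_of_borelSerre'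
    Summit.Langlands.Langlands.Theorems.HeckeEigenvalueField.Res.borelSerre1973_finiteDimensional_groupCohomology_congruenceSubgroup_holds
    (PadicAlgCl p) 2 F 𝔫 h𝔫 lam q

end Summit.Langlands.Langlands.Cruxes.CrystallineProModularClassical.TorsionWeightExchange

end

/- FEASIBILITY: discharging Borel–Serre for n = 2, F totally real
Moot — already discharged in the tree in full generality.  The named fact
`Literature.NumberTheory.Automorphic.BorelSerre1973_finiteDimensional_groupCohomology_congruenceSubgroup`
(∀ field k, ∀ n, ∀ number field K, ∀ compact open U ≤ GL_n(𝔸_K^∞), ∀ fd `A : Rep k Γ_U`, ∀ q,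
`Module.Finite k (groupCohomology A q)`) is the THEOREM
`Summit.Langlands.Langlands.Theorems.HeckeEigenvalueField.Res.borelSerre1973_finiteDimensional_groupCohomology_congruenceSubgroup_holds`
of `Summits/Langlands/Langlands/Theorems/IrreducibilityBySelfDualityHeckeEigenvalueFieldBorelSerre.lean`
(crux `HeckeEigenvalueField`, line `Sketch`, B programme: Brown's criterion in Čech form
`stub_borelSerre_assembly` on the cone model with the Siegel-reduced good cover — stubs
`stub_hull_convex` = `SiegelFamily.convexHull_isReduced_subset`, `stub_hull_relOpen`,
`stub_hull_posDef`, `stub_sandwich_in`, `stub_sandwich_out`), axiom closure checked here with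
`#print axioms`: {propext, Classical.choice, Quot.sound}.  It lives Summits-side (same summit and
problem `Langlands/Langlands`, importable by Theorems files per CONVENTIONS §2) rather than in
Literature, which is why `lean search '_holds'` restricted to `Literature/` does not show it and why
the Literature file `CongruenceSubgroupCohomologyFiniteDimensional` still says "unproved".  A
Literature-side `…_holds` would require re-landing the five Summits stubs under `Literature/`
(Literature never imports Summits); that is a relocation job (≈ 6 files, ~2000 lines, proofs
unchanged), not new mathematics, and is not needed by this line.  The Bianchi/Koecher-cone route of
`BianchiCusp.isCohFiniteTypeUpTo_glIntegersRange` (n = 2, imaginary quadratic) is therefore not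
needed for (n = 2, F totally real) either. -/
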